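import Summits.Ventures.KdS.RouteWSpinFlipProp38
import Summits.Ventures.KdS.RouteWSpinFlipPoly
import Summits.Ventures.KdS.SpinFlipEulerForm
import HarnessLib

/-!
# Venture KdS — the spin flip on the cosmological lattice (III): every stratum is excluded by
# the formal Euler partner; Casals–Teixeira da Costa's Proposition 3.8 for EVERY spin

HONEST FRAMING (venture `Summits/Ventures/KdS`, cell `pub-kds`; LIT-1 g22 under lead ruling A86,
recipe `theory/P1-HANDOFF-g5.md §RESIDUAL`). `RouteWSpinFlipProp38.lean` proved the conclusion of
the cited fact `CasalsTeixeiraDaCosta2022_partialModeStabilityProp38` (H3) for every half-integer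
spin `s ≤ 2` and left, for `s ≥ 5/2`, the NON-EXTREME strata of the cosmological lattice
(`Re ω = mϖ₂`, `Im ω = jκ₂`, `0 < Im ω ≤ (s−2)κ₂`), where the kernel of the Teukolsky–Starobinsky
map consists of `weight × polynomial of positive degree`. This file closes ALL lattice strata at
once (`radial_vanishing_lattice`), uniformly in the stratum: by `spinFlip_polynomial` the
Hatsuda-gauge function is `x^{1−γ}(z_r−x)^{1−ε}·r(x)` with `r` a polynomial; in Casals–Teixeira da
Costa's Euler gauge (`GeneralHeun.mobiusV`, `accessoryIdentity_holds`) this is the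
Frobenius-polynomial function `v = Σ_k a_k (w−1)^{ρ+k}`, `ρ = 2η₁ − s` (`mobiusV_eq_cpow_mul_eval`,
`cpow_mul_eval_eq_cpowSum`); its
three-term recurrence (`SpinFlipFrobenius`) transfers termwise (`SpinFlipIntertwine`) to the partner
`ṽ = Σ_k b_k (w−1)^{2(η₀+η₁)+k}`, a solution of the `m₂ ↔ m₃`-SWAPPED Euler-gauge equation
(Takemura's map with exponent `η = α`, `euler_swap_*`) carrying the mode-data branches; the landed
`gaugeGlue_holds` and `swappedEnergyVanishing_holds` (energy identity of CTdC's Thm 3.10 Step 2)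
force `ṽ ≡ 0`, hence `b ≡ 0`, hence — off the resonances `ρ+1+i = 0` (excluded off the event
threshold ray `Re ω = mϖ₁`) and `2(η₀+η₁)+1+i = 0` (excluded by the pair condition `p₃`) — `a ≡ 0`,
`v ≡ 0`, `R ≡ 0`. A direct proof, no partner guessing; for `j = 2s−1` it re-proves the extreme
stratum of `RouteWSpinFlipLattice.lean`.

CONSEQUENCES (0 cited facts): `radial_vanishing_halfInt` — CTdC Prop. 3.8's conclusion for EVERY
half-integer spin `s ≥ 1/2` on the whole open upper half-plane, under `Im(λ̄ω̄) ≤ 0`,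
`|ω| ∉ |m|(0,Ω_SR)`, `p₃`, and the pair condition `p₁` for `s − 2η₁` (used only ON the event ray,
where it reads `Im ω > (s−1)κ₁` and the landed `radial_vanishing_of_im_gt` applies);
`prop38_allSpins` (every `s ∈ ½ℤ`); and **`partialModeStabilityProp38_holds :
CasalsTeixeiraDaCosta2022_partialModeStabilityProp38`** — the cited Literature fact H3 is now a
THEOREM of the tree (its binders `|a| < 3/Λ`, `m − s ∈ ℤ`, `Σm_j ∉ ℤ_{≥2}`, `p₂`, `p₄` are not
used). THE TYPED RESIDUAL `RouteW.NonExtremeStrata` (P1 g5, `RouteWSpinFlipResidual.lean`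
@e943ebba68d4) omits `p₁`; T3 does NOT route through `prop38_of_nonExtremeStrata`: at the
doubly-resonant lattice points `Re ω = mϖ₁ ∧ (j−s)κ₂ = (s−1−i₀)κ₁` (forcing `m(ϖ₁−ϖ₂) = 0`) the
weights `W_k`, `k > i₀`, vanish (`ρ = −(i₀+1)`: the branch `(w−1)^ρ` collides with the analytic
exponent), polynomial Euler-gauge candidates of degree `D−1−i₀` survive the partner argument, and it
is exactly H3's `p₁` (`Im ω > (s−1)κ₁` on the event ray) that excludes them; the corrected interface
is `nonExtremeStrata_offEventRay`. No claim beyond these displayed statements.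
-/

noncomputable section

open Set Complex Filter Topology Finset Polynomial

namespace Summit.Ventures.KdS

namespace RouteW

open Literature.Analysis.ODE Literature.Analysis.ODE.GeneralHeun
open Literature.Geometry.Lorentzian Literature.Geometry.Lorentzian.KerrDeSitter
open SpinFlipTS

/-! ### Every lattice stratum is excluded -/

/-- **CTdC Prop. 3.8's conclusion at EVERY point of the cosmological lattice, off the event
threshold ray.** For subextremal `(M,a,Λ)`, `0 ≤ a`, `2s = N ≥ 1`, `Im ω > 0`, `Im(λ̄ω̄) ≤ 0`,
`|ω| ∉ |m|(0,Ω_SR)`, the pair condition for `−2(η₁+η₀)`, `Re ω ≠ mϖ₁`, and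
`s + 2B(r_c) = j ∈ ℕ` with `j + 1 ≤ N`: every generic-boundary radial Teukolsky solution of spin `s`
vanishes on `(r₊, r_c)` (the image of `spinFlip_polynomial` vanishes by route W; the Euler-gauge
function `Σ_{k≤D} a_k (w−1)^{ρ+k}` of `R` has the formal Euler partner `Σ b_k (w−1)^{2(η₀+η₁)+k}`,
a swapped-equation mode datum killed by `gaugeGlue_holds` + `swappedEnergyVanishing_holds`; the
weights do not vanish: `Im ρ ≠ 0` off the event ray, `2(η₀+η₁) ∉ −ℕ₊` by `p₃`). PROVED, 0 facts. -/
theorem radial_vanishing_lattice {M a Λ s : ℝ} {ω : ℂ} {m : ℝ} {lam : ℂ} {R : ℝ → ℂ}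
    (hsub : IsSubextremal M a Λ) (ha : 0 ≤ a) {N : ℕ} (hN1 : 1 ≤ N) (hsN : 2 * s = N)
    (hω : 0 < ω.im) (hlam : (lambdaBar a Λ s ω m lam * (starRingEnd ℂ) ω).im ≤ 0)
    (hSR : ¬(0 < ‖ω‖ ∧ ‖ω‖ < |m| * superradiantUpper M a Λ))
    (hp₃ : PairCondition (-2 * (etaEvent M a Λ ω m + etaCauchy M a Λ ω m)))
    (hray : ω.re ≠ m * horizonAngVel a (rPlus M a Λ))
    {j : ℕ} (hjN : j + 1 ≤ N) (hlat : (s : ℂ) + 2 * horizonB M a Λ ω m (rCosmo M a Λ) = (j : ℂ))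
    (hR : IsRadialTeukolskySolution M a Λ s ω m lam R) (hin : IsIngoingAtEventHorizon M a Λ s ω m R)
    (hout : IsOutgoingAtCosmoHorizon M a Λ ω m R) :
    ∀ r ∈ Ioo (rPlus M a Λ) (rCosmo M a Λ), R r = 0 := by
  -- (0) the spin-flip image vanishes by route W; the Hatsuda function is `x^{1−γ}(z_r−x)^{1−ε}·r`
  obtain ⟨R', hR', hin', hout', hpoly⟩ :=
    spinFlip_polynomial M a Λ s ω m lam R N hsub hN1 hsN hR hin hout
  have hN' : (1 : ℝ) ≤ N := by exact_mod_cast hN1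
  have hs' : -s < 1 := by linarith
  have hlam' : (lambdaBar a Λ (-s) ω m (lamFlip a Λ s lam) * (starRingEnd ℂ) ω).im ≤ 0 := by
    rw [lambdaBar_lamFlip]; exact hlam
  have hR'0 := radial_vanishing_lt_one hsub ha hs' hω hlam' hSR hp₃ hR' hin' hout'
  obtain ⟨r, hrdeg, hyr⟩ := hpoly hR'0 j hjN hlat
  -- abbreviations
  set η₀ := etaCauchy M a Λ ω m with hη₀
  set η₁ := etaEvent M a Λ ω m with hη₁
  set η₂ := etaCosmo M a Λ ω m with hη₂
  set z₂ := zTwo M a Λ with hz₂def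
  set zr := mobiusZr M a Λ with hzrdef
  have hz₂ : 1 < z₂ := one_lt_zTwo hsub
  have hzr1 : 1 < zr := one_lt_mobiusZr hsub
  have hzr0 : 0 < zr := by linarith
  have hA' : zr / (zr - 1) = z₂ := mobiusA_mobiusZr hsub
  set D : ℕ := N - 1 - j with hDdef
  have hDj : D + j + 1 = N := by omega
  have hrD : r.natDegree ≤ D := by omega
  set y : ℝ → ℂ := fun x => R (mobiusInv M a Λ x) / heunWeight M a Λ s ω m (mobiusInv M a Λ x)
    with hy
  -- (1) the Euler-gauge equation for `v = z^{−σ₋} y(z_r(z−1)/z)` on `(1, z₂)`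
  have hysol := heunSolution_of_isRadialTeukolskySolution hsub hR
  have hV : ∀ z ∈ Ioo 1 z₂, 0 < z ∧ mobiusX zr z ∈ Ioo (0 : ℝ) 1 := by
    intro z hz
    obtain ⟨hz1, hzz⟩ := hz
    have hz0 : 0 < z := by linarith
    refine ⟨hz0, ?_, ?_⟩
    · unfold mobiusX
      exact div_pos (mul_pos hzr0 (by linarith)) hz0
    · unfold mobiusX
      rw [div_lt_one hz0]
      rw [← hA'] at hzz
      have h1 : z * (zr - 1) < zr := (lt_div_iff₀ (by linarith)).mp hzz
      nlinarith
  have hmob := isSolutionOn_mobius (heun_fuchs hsub s ω m) (ne_of_gt hzr1) hV hysol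
  rw [accessoryIdentity_holds M a Λ s ω m lam hsub, mobiusβ_eq hsub, mobiusγ_eq hsub,
    heunGamma_eq hsub, heunDelta_eq hsub, heunSigmaMinus_eq hsub, hzrdef, mobiusA_mobiusZr hsub]
    at hmob
  -- the Euler-gauge parameters
  set m₁ := mass₁ M a Λ s ω m with hm₁
  set m₂ := mass₂ M a Λ ω m with hm₂
  set m₃ := mass₃ M a Λ s ω m with hm₃
  set m₄ := mass₄ M a Λ ω m with hm₄
  set E := bigE M a Λ s ω m lam with hE
  set ρ : ℂ := 2 * η₁ - (s : ℂ) with hρdef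
  set η : ℂ := eulerGaugeα m₂ m₃ with hηdef
  have hF := eulerGauge_fuchs m₁ m₂ m₃ m₄
  have hroot : (η - eulerGaugeα m₂ m₃) * (η - eulerGaugeβ m₂ m₄) = 0 := by rw [hηdef]; ring
  have hρ : ρ = 1 - eulerGaugeδ m₁ m₂ := by
    rw [hm₁, hm₂]; unfold mass₁ mass₂; rw [eulerGaugeδ_eta]; ring
  have hηval : η = 1 + (s : ℂ) + 2 * η₀ := by
    rw [hηdef, hm₂, hm₃]; unfold mass₂ mass₃; rw [eulerGaugeα_eta]
  -- (2) the explicit Frobenius-polynomial form of `v` on `(1, z₂)`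
  set c₀ : ℂ := eulerKernel (heunGamma M a Λ s ω m + heunEps M a Λ s ω m - 2) zr with hc₀
  set A : Polynomial ℂ := shiftPoly zr D r with hAdef
  set aC : ℕ → ℂ := fun k => c₀ * A.coeff k with haC
  have hAdeg : A.natDegree ≤ D := shiftPoly_natDegree_le zr D r
  have hκ : heunGamma M a Λ s ω m + heunEps M a Λ s ω m - 2 - heunSigmaMinus M a Λ s ω m = (D : ℂ) := by
    have hFH := heun_fuchs hsub s ω m
    have hσ : heunSigmaPlus s = (N : ℂ) + 1 := by
      have := two_sub_sigmaPlus s hsN; linear_combination -this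
    have hδ : heunDelta M a Λ s ω m = (j : ℂ) + 1 := by
      have := delta_sub_one M a Λ s ω m; rw [hlat] at this; linear_combination this
    have hDc : (D : ℂ) = (N : ℂ) - 1 - (j : ℂ) := by
      have : ((D + j + 1 : ℕ) : ℂ) = (N : ℂ) := by rw [hDj]
      push_cast at this; linear_combination this
    rw [hDc]; linear_combination hFH + hσ - hδ
  have hκ' : heunGamma M a Λ s ω m + heunEps M a Λ s ω m - 2 - η = (D : ℂ) := by
    rw [hηdef, hm₂, hm₃, ← heunSigmaMinus_eq hsub s ω m]; exact hκ
  have hγρ : 1 - heunGamma M a Λ s ω m = ρ := by rw [hρdef, hη₁]; exact one_sub_heunGamma hsub s ω m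
  have hv_eq : ∀ w ∈ Ioo 1 z₂, mobiusV zr η y w = cpowSum ρ aC (D + 1) w := by
    intro w hw
    obtain ⟨-, hx⟩ := hV w hw
    rw [mobiusV_eq_cpow_mul_eval hzr0 hrD hκ' hyr hw.1 hx, hγρ]
    exact cpow_mul_eval_eq_cpowSum hAdeg c₀ ρ hw.1
  have hsolF : IsSolutionOn (z₂ : ℂ) (eulerGaugeα m₂ m₃) (eulerGaugeβ m₂ m₄) (eulerGaugeγ m₁ m₂)
      (eulerGaugeδ m₁ m₂) (eulerGaugeε m₃ m₄) (eulerGaugeQ m₁ m₂ m₃ m₄ E (z₂ : ℂ)) (Ioo 1 z₂)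
      (cpowSum ρ aC (D + 1)) :=
    SpinFlipTS.IsSolutionOn.congr_eqOn isOpen_Ioo hmob fun w hw => hv_eq w hw
  -- (3) the formal Euler partner solves the swapped equation
  have haC0 : ∀ k, D < k → aC k = 0 := by
    intro k hk
    simp only [haC]
    rw [coeff_eq_zero_of_natDegree_lt (lt_of_le_of_lt hAdeg hk), mul_zero]
  set b : ℕ → ℂ := partnerCoeff ρ η D aC with hbdef
  set ρt : ℂ := 2 * (η₀ + η₁) with hρt
  have hρt' : ρ + η - 1 = ρt := by rw [hηval, hρdef, hρt]; ring
  have hpart := isSolutionOn_partner hz₂ hF hroot hρ haC0 hsolF z₂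
  rw [hηdef, euler_swap_α, euler_swap_β, euler_swap_γ, euler_swap_δ, euler_swap_ε, euler_swap_q,
    ← hηdef, hρt'] at hpart
  -- (4) mode data of the partner, gauge glue, energy identity
  have hdata := heunModeData_cpowSum hz₂ hpart
  obtain ⟨Rt, hRt, hRtinj⟩ := gaugeGlue_holds z₂ m₁ m₃ m₂ m₄ E ρt _ hz₂ hdata
  have he₁ : ρt + eulerGaugeδ m₁ m₃ / 2 = 1 / 2 + etaCauchy M a Λ ω m + etaEvent M a Λ ω m := by
    rw [hm₁, hm₃]; unfold mass₁ mass₃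
    rw [eulerGaugeδ_swap_eta, hρt, hη₀, hη₁]
    ring
  have he₂ : eulerGaugeε m₂ m₄ / 2 = 1 / 2 - etaCauchy M a Λ ω m - etaCosmo M a Λ ω m := by
    rw [hm₂, hm₄]; unfold mass₂ mass₄
    rw [eulerGaugeε_swap_eta]
    ring
  rw [he₁, he₂] at hRt
  have hsub' := hsub
  obtain ⟨hM, hΛ, h01, h12, -⟩ := hsub'
  have hr₀ : 0 ≤ rMinus M a Λ := rMinus_nonneg M a Λ
  have hcoef : ∀ z ∈ Ioo 1 z₂,
      sqcdCoeff m₁ m₃ m₂ m₄ E (z₂ : ℂ) z = tildeCoeff M a Λ s ω m lam z := by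
    intro z hz
    obtain ⟨hz1, hzz⟩ := hz
    rw [hm₁, hm₂, hm₃, hm₄, hE]
    unfold tildeCoeff bigE mass₁ mass₂ mass₃ mass₄
    rw [hz₂def] at hzz ⊢
    unfold zTwo
    symm
    refine ctdcTilde_eq_sqcd_swap (s : ℂ) η₀ η₁ η₂ (ltBlock M a Λ s ω m lam) ?_ ?_ ?_ ?_ ?_ ?_ ?_
    · exact_mod_cast (sub_pos.mpr h01).ne'
    · have : 0 < rCosmo M a Λ + (rMinus M a Λ + rPlus M a Λ + rCosmo M a Λ) := by linarith
      exact_mod_cast this.ne'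
    · have : 0 < rPlus M a Λ + rCosmo M a Λ := by linarith
      exact_mod_cast this.ne'
    · have : (0 : ℝ) < z := by linarith
      exact_mod_cast this.ne'
    · exact sub_ne_zero.mpr (by exact_mod_cast (ne_of_gt hz1))
    · unfold zTwo at hzz
      exact sub_ne_zero.mpr (by exact_mod_cast (ne_of_gt hzz))
    · rw [hz₂def] at hz₂
      unfold zTwo at hz₂
      have : (0 : ℝ) < ctdcZ₂ (rMinus M a Λ) (rPlus M a Λ) (rCosmo M a Λ) := by linarith
      exact_mod_cast this.ne'
  have hRt' : NormalFormModeData z₂ (tildeCoeff M a Λ s ω m lam)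
      (1 / 2 + etaCauchy M a Λ ω m + etaEvent M a Λ ω m)
      (1 / 2 - etaCauchy M a Λ ω m - etaCosmo M a Λ ω m) Rt := hRt.congr hcoef
  have hRt0 := swappedEnergyVanishing_holds M a Λ s ω m lam Rt hsub ha hω hlam hSR hRt'
  have hvt0 : ∀ w ∈ Ioo 1 z₂, cpowSum ρt b (D + 1) w = 0 := hRtinj hRt0
  -- (5) `b ≡ 0`, the weights do not vanish, `a ≡ 0`
  have hb0 := coeff_eq_zero_of_cpowSum_eq_zero hz₂ hvt0
  have hκ₁ := surfaceGravity_rPlus_pos hsub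
  have h1 : ∀ i : ℕ, ρ + 1 + i ≠ 0 := by
    intro i h
    have him := congrArg Complex.im h
    simp only [hρdef, Complex.add_im, Complex.sub_im, Complex.mul_im, Complex.ofReal_im,
      Complex.natCast_im, Complex.one_im, Complex.zero_im, hη₁, etaEvent_im,
      Complex.re_ofNat, Complex.im_ofNat] at him
    have : ω.re - m * horizonAngVel a (rPlus M a Λ) = 0 := by
      have h2 : (2 : ℝ) * surfaceGravity M a Λ (rPlus M a Λ) ≠ 0 := by positivity
      field_simp at him
      linarith
    exact hray (sub_eq_zero.mp this)
  have h2 : ∀ i : ℕ, ρ + η + i ≠ 0 := by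
    intro i h
    have hnr := nonres_of_pairCondition (η₀ := η₀) (η₁ := η₁) (by rw [hη₀, hη₁]; exact hp₃) i
    apply hnr
    rw [hηval, hρdef] at h
    linear_combination h
  have ha0 : ∀ k, aC k = 0 := by
    intro k
    by_cases hk : k < D + 1
    · exact eq_zero_of_partnerCoeff_eq_zero h1 h2 (hb0 k hk)
    · exact haC0 k (by omega)
  -- (6) `v ≡ 0` on `(1, z₂)`, hence `R ≡ 0` on `(r₊, r_c)`
  have hv0 : ∀ w ∈ Ioo 1 z₂, mobiusV zr η y w = 0 := by
    intro w hw
    rw [hv_eq w hw]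
    unfold cpowSum
    exact sum_eq_zero fun k _ => by rw [ha0 k, zero_mul]
  intro rr hr
  have hx := mobiusZ_mem_Ioo hsub hr
  set x := mobiusZ M a Λ rr with hxdef
  obtain ⟨hx0, hx1⟩ := hx
  have hzx : 0 < zr - x := by linarith
  have hw1 : 1 < zr / (zr - x) := by rw [lt_div_iff₀ hzx]; linarith
  have hw2 : zr / (zr - x) < z₂ := by
    rw [← hA', div_lt_div_iff_of_pos_left hzr0 hzx (by linarith)]
    linarith
  have hX : mobiusX zr (zr / (zr - x)) = x := by
    unfold mobiusX
    field_simp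
    ring
  have h0 := hv0 _ ⟨hw1, hw2⟩
  simp only [mobiusV] at h0
  rw [hX] at h0
  rcases mul_eq_zero.mp h0 with hk | hyx
  · exact absurd hk (eulerKernel_ne_zero _ _)
  · have hrm : rr ≠ rMinus M a Λ := by
      intro h; rw [h] at hr; exact absurd hr.1 (by linarith)
    have hinv := mobiusInv_mobiusZ hsub hrm
    simp only [hy, hxdef] at hyx
    rw [hinv] at hyx
    rcases div_eq_zero_iff.mp hyx with hR0 | hw0
    · exact hR0
    · exact absurd hw0 (heunWeight_ne_zero hsub s ω m hr)

/-! ### Casals–Teixeira da Costa's Proposition 3.8 for every spin -/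

/-- **CTdC Prop. 3.8's conclusion for EVERY half-integer spin `s ≥ 1/2` on the open upper
half-plane.** Hypotheses: subextremal, `0 ≤ a`, `2s = N ≥ 1`, `Im ω > 0`, `Im(λ̄ω̄) ≤ 0`,
`|ω| ∉ |m|(0,Ω_SR)`, and Prop. 3.8's pair conditions for `s − 2η₁` (`p₁`) and `−2(η₁+η₀)` (`p₃`).
Above `(s−1)κ₁`: `radial_vanishing_of_im_gt`; off the lattice: `radial_vanishing_offLattice`; on
the lattice: `radial_vanishing_lattice` — there `Re ω = mϖ₂`, and the event ray `Re ω = mϖ₁` is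
excluded because on it `p₁` says `Im ω > (s−1)κ₁`. PROVED, 0 cited facts. -/
theorem radial_vanishing_halfInt {M a Λ s : ℝ} {ω : ℂ} {m : ℝ} {lam : ℂ} {R : ℝ → ℂ}
    (hsub : IsSubextremal M a Λ) (ha : 0 ≤ a) {N : ℕ} (hN1 : 1 ≤ N) (hsN : 2 * s = N)
    (hω : 0 < ω.im) (hlam : (lambdaBar a Λ s ω m lam * (starRingEnd ℂ) ω).im ≤ 0)
    (hSR : ¬(0 < ‖ω‖ ∧ ‖ω‖ < |m| * superradiantUpper M a Λ))
    (hp₁ : PairCondition ((s : ℂ) - 2 * etaEvent M a Λ ω m))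
    (hp₃ : PairCondition (-2 * (etaEvent M a Λ ω m + etaCauchy M a Λ ω m)))
    (hR : IsRadialTeukolskySolution M a Λ s ω m lam R) (hin : IsIngoingAtEventHorizon M a Λ s ω m R)
    (hout : IsOutgoingAtCosmoHorizon M a Λ ω m R) :
    ∀ r ∈ Ioo (rPlus M a Λ) (rCosmo M a Λ), R r = 0 := by
  by_cases hhi : (s - 1) * surfaceGravity M a Λ (rPlus M a Λ) < ω.im
  · exact radial_vanishing_of_im_gt hsub ha hhi hω hlam hSR hp₃ hR hin hout
  by_cases hoff : OffLattice M a Λ s ω m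
  · exact radial_vanishing_offLattice hsub ha hN1 hsN hω hlam hSR hp₃ hoff hR hin hout
  -- on the lattice: `s + 2B(r_c) = j`, `1 ≤ j ≤ N − 1`
  obtain ⟨j, hj, hj'⟩ : ∃ j : ℤ, (j : ℝ) ≤ 2 * s - 1 ∧
      (s : ℂ) + 2 * horizonB M a Λ ω m (rCosmo M a Λ) = j := by
    by_contra h
    exact hoff fun j hj hj' => h ⟨j, hj, hj'⟩
  have hκ₂ := surfaceGravity_rCosmo_pos hsub
  have hκ₁ := surfaceGravity_rPlus_pos hsub
  have hre := congrArg Complex.re hj'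
  rw [horizonB_rCosmo_eq_neg_etaCosmo hsub] at hre
  simp [etaCosmo_re] at hre
  have hN' : (1 : ℝ) ≤ N := by exact_mod_cast hN1
  have hs0 : 0 < s := by linarith
  have hquot : 0 < ω.im / (2 * surfaceGravity M a Λ (rCosmo M a Λ)) := div_pos hω (by positivity)
  have hj0 : (0 : ℝ) < j := by linarith
  obtain ⟨j₀, hj₀⟩ : ∃ j₀ : ℕ, (j₀ : ℤ) = j := ⟨j.toNat, Int.toNat_of_nonneg (by exact_mod_cast hj0.le)⟩
  have hj₀N : j₀ + 1 ≤ N := by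
    have h1 : ((j₀ : ℤ) : ℝ) ≤ 2 * s - 1 := by rw [hj₀]; exact hj
    have h2 : (j₀ : ℝ) + 1 ≤ (N : ℝ) := by push_cast at h1; linarith
    exact_mod_cast h2
  have hlat : (s : ℂ) + 2 * horizonB M a Λ ω m (rCosmo M a Λ) = (j₀ : ℂ) := by
    rw [hj']
    have : ((j : ℤ) : ℂ) = ((j₀ : ℕ) : ℂ) := by rw [← hj₀]; norm_cast
    exact this
  -- off the event ray, by `p₁` and `¬hhi`
  have hray : ω.re ≠ m * horizonAngVel a (rPlus M a Λ) := by
    intro heq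
    have him : ((s : ℂ) - 2 * etaEvent M a Λ ω m).im = 0 := by
      simp [etaEvent_im, heq]
    have h := hp₁ him
    simp [etaEvent_re] at h
    have h2 : 2 * (ω.im / (2 * surfaceGravity M a Λ (rPlus M a Λ))) =
        ω.im / surfaceGravity M a Λ (rPlus M a Λ) := by field_simp
    have h3 : s - 1 < ω.im / surfaceGravity M a Λ (rPlus M a Λ) := by linarith
    exact hhi ((lt_div_iff₀ hκ₁).mp h3)
  exact radial_vanishing_lattice hsub ha hN1 hsN hω hlam hSR hp₃ hray hj₀N hlat hR hin hout

/-- **H3 for every spin `s ∈ ½ℤ`**: the conclusion of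
`CasalsTeixeiraDaCosta2022_partialModeStabilityProp38` under its binders subextremal, `0 ≤ a`,
`2s ∈ ℤ`, `Im ω > 0`, `Im(λ̄ω̄) ≤ 0`, `|ω| ∉ |m|(0,Ω_SR)`, `p₁`, `p₃` (the binders `|a| < 3/Λ`,
`m − s ∈ ℤ`, `Σm_j ∉ ℤ_{≥2}`, `p₂`, `p₄` are not needed). For `s < 1` this is route W
(`radial_vanishing_lt_one`); for `s ≥ 1`, `radial_vanishing_halfInt`. PROVED, 0 cited facts. -/
theorem prop38_allSpins (M a Λ s : ℝ) (ω : ℂ) (m : ℝ) (lam : ℂ)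
    (hsub : IsSubextremal M a Λ) (ha : 0 ≤ a) (h2s : ∃ k : ℤ, 2 * s = k) (hω : 0 < ω.im)
    (hlam : (lambdaBar a Λ s ω m lam * (starRingEnd ℂ) ω).im ≤ 0)
    (hSR : ¬(0 < ‖ω‖ ∧ ‖ω‖ < |m| * superradiantUpper M a Λ))
    (hp₁ : PairCondition ((s : ℂ) - 2 * etaEvent M a Λ ω m))
    (hp₃ : PairCondition (-2 * (etaEvent M a Λ ω m + etaCauchy M a Λ ω m)))
    (R : ℝ → ℂ) (hR : IsRadialTeukolskySolution M a Λ s ω m lam R)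
    (hin : IsIngoingAtEventHorizon M a Λ s ω m R) (hout : IsOutgoingAtCosmoHorizon M a Λ ω m R) :
    ∀ r ∈ Ioo (rPlus M a Λ) (rCosmo M a Λ), R r = 0 := by
  by_cases hs : s < 1
  · exact radial_vanishing_lt_one hsub ha hs hω hlam hSR hp₃ hR hin hout
  · obtain ⟨k, hk⟩ := h2s
    have hk1 : (1 : ℤ) ≤ k := by
      have : (1 : ℝ) ≤ (k : ℝ) := by rw [← hk]; linarith
      exact_mod_cast this
    obtain ⟨N, hNk⟩ : ∃ N : ℕ, (N : ℤ) = k := ⟨k.toNat, Int.toNat_of_nonneg (by omega)⟩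
    have hsN : 2 * s = (N : ℝ) := by
      rw [hk]; exact_mod_cast hNk.symm
    have hN1 : 1 ≤ N := by exact_mod_cast (hNk ▸ hk1 : (1 : ℤ) ≤ (N : ℤ))
    exact radial_vanishing_halfInt hsub ha hN1 hsN hω hlam hSR hp₁ hp₃ hR hin hout

/-- **The corrected interface to the typed residual.** `RouteW.NonExtremeStrata` (P1 g5,
`RouteWSpinFlipResidual.lean`) with ONE extra binder — off the event threshold ray `Re ω ≠ mϖ₁`,
or H3's pair condition `p₁` for `s − 2η₁` — is a theorem (off the ray `p₁` holds vacuously,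
`pairCondition_of_im_ne`). As typed, `NonExtremeStrata` omits `p₁`; see the module docstring. -/
theorem nonExtremeStrata_offEventRay (M a Λ s : ℝ) (ω : ℂ) (m : ℝ) (lam : ℂ) (R : ℝ → ℂ)
    (hsub : IsSubextremal M a Λ) (ha : 0 ≤ a) (h2s : ∃ k : ℤ, 2 * s = k) (hω : 0 < ω.im)
    (_hle : ω.im ≤ (s - 2) * surfaceGravity M a Λ (rCosmo M a Λ))
    (_hlat : ¬OffLattice M a Λ s ω m)
    (hlam : (lambdaBar a Λ s ω m lam * (starRingEnd ℂ) ω).im ≤ 0)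
    (hSR : ¬(0 < ‖ω‖ ∧ ‖ω‖ < |m| * superradiantUpper M a Λ))
    (hp₃ : PairCondition (-2 * (etaEvent M a Λ ω m + etaCauchy M a Λ ω m)))
    (hray : ω.re ≠ m * horizonAngVel a (rPlus M a Λ) ∨
      PairCondition ((s : ℂ) - 2 * etaEvent M a Λ ω m))
    (hR : IsRadialTeukolskySolution M a Λ s ω m lam R) (hin : IsIngoingAtEventHorizon M a Λ s ω m R)
    (hout : IsOutgoingAtCosmoHorizon M a Λ ω m R) :
    ∀ r ∈ Ioo (rPlus M a Λ) (rCosmo M a Λ), R r = 0 := by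
  have hp₁ : PairCondition ((s : ℂ) - 2 * etaEvent M a Λ ω m) := by
    rcases hray with hray | hp₁
    · have hκ₁ := surfaceGravity_rPlus_pos hsub
      refine pairCondition_of_im_ne ?_
      have him : ((s : ℂ) - 2 * etaEvent M a Λ ω m).im =
          (ω.re - m * horizonAngVel a (rPlus M a Λ)) / surfaceGravity M a Λ (rPlus M a Λ) := by
        simp [etaEvent_im]
        field_simp
      rw [him]
      exact div_ne_zero (sub_ne_zero.mpr hray) hκ₁.ne'
    · exact hp₁
  exact prop38_allSpins M a Λ s ω m lam hsub ha h2s hω hlam hSR hp₁ hp₃ R hR hin hout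

/-- **The cited fact H3 is a theorem of the tree.** Casals–Teixeira da Costa's Proposition 3.8
(with Lemma 3.5, the proof of Corollary 3.9 and Step 2 of the proof of Theorem 3.10), as vendored
in `Literature.Geometry.Lorentzian.KerrDeSitter.CasalsTeixeiraDaCosta2022_partialModeStabilityProp38`
(`KerrDeSitterThresholdRays.lean`), holds: PROVED from route W (`Transfer`, `EulerRL` for the
integrable branch, `GaugeGlue`, `SwappedEnergyVanishing` — all theorems), the spin flip off the
lattice and the formal Euler partner on the lattice. 0 cited facts. -/
theorem partialModeStabilityProp38_holds : CasalsTeixeiraDaCosta2022_partialModeStabilityProp38 := by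
  intro M a Λ s ω m lam hsub ha _ h2s _ hω hlam hSR _ hp₁ _ hp₃ _ R hR hin hout
  exact prop38_allSpins M a Λ s ω m lam hsub ha h2s hω hlam hSR hp₁ hp₃ R hR hin hout

end RouteW

end Summit.Ventures.KdS
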